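import Summits.BirchSwinnertonDyer.BirchSwinnertonDyer.Theorems.ManinLocalTwoThreeThreeShiftGlue
import HarnessLib

/-!
# The 2-ADIC TWIN of the nine-shift equaliser chain, I: vocabulary at `p = 2`, the laws G₂ / G₈, sanity
# (route `ManinLocalTwoThree`, cell bsd-f2-manin; crux C2 `ManinOddAtFour` stmt-BirchSwinnertonDyer-22967; prover seat p3 gen 11,
# ASK A-p3-1 «2-adic twin» of HANDOFF «p3 gen 10»)

The `p = 3` chain of the cell (es g23 MEMO-es §37; tree `…/ManinAdditive/NineShiftEqualiserLaw.lean`, E-es-94♯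
`NineShiftInvariantIsDiamond`, now a THEOREM `nineShiftInvariantIsDiamond_holds`) speaks about additive characters
`Γ₀(N) → 𝔽₃` invariant under `γ ↦ diag(9,1) γ diag(9,1)⁻¹`.  This file opens its `p = 2` twin, for additive maps
`φ : Γ₀(N) → K` into an arbitrary commutative ring `K` (the laws themselves at `K = ℤ/2`):
* `IsAdd`, `IsShiftEigen ε φ` (`φ(a, 2b; c, d) = ε·φ(a, b; 2c, d)` on `Γ₀(2N)`; `ε = 1`: `IsTwoShiftInvariant`),
  `IsFourShiftInvariant`, `IsEightShiftInvariant`, `IsDiamond` (vanishing on `Γ₁(N)`), `RestrictsFrom`, single-level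
  schemas `TwoShiftInvariantIsDiamondAt N`, `ShiftEigenTrivialAt N ε`;
* the laws **G₂ `TwoShiftInvariantIsDiamond`** (`∀ N ≥ 1`: a 2-shift-invariant additive `Γ₀(N) → ℤ/2` is diamond — the twin of
  E-es-96, at EVERY level, odd or even) and **G₈ `EightShiftInvariantIsDiamond`** (the twin of E-es-94♯ with `t = 8`, the ratio
  of the C2 consumer `twoAdicPolarWitness_of_degeneracyEightPlusIndex`);
* sanity (PROVED): `D ⊆ K₂ ⊆ K₄ ⊆ K₈`, restriction of a diamond class is diamond, `RestrictsFrom` is pointwise, parity facts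
  at an even level (`two_dvd_of_det`) and the DICHOTOMY behind «`Q₁` generates `A/(A ∩ B)`».
CENSUS (seat engine HOME/p3/g11/rs_equaliser.py, Reidemeister–Schreier over `𝔽₂`, validated against es ENGINE 4 at `p = 3`):
`dim K_t(N) = r₂((ℤ/N)ˣ) = dim D(N)` for `t = 8` at all 13 levels `4 ∣ N ≤ 48` and all `N ≤ 15`; `t = 2` at all `N ≤ 35`;
`t = 4` at `N ∈ {2,…,20}`; the ω-part `K^ω(M) = 0` at all `M ≤ 32`.  The two laws are typed `@[conjecture]` here (nothing
asserted); the sibling files prove G₂ at every level and reduce G₈ to G₂ plus the ω-part.  Nothing about BSD, Manin's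
conjecture or C2 is proved by this file.  Reference: cell memo HOME/MEMO-es.md §37 [cite: DarmonDiamondTaylor1995, Lemma 4.28 (p. 135)].
-/

set_option autoImplicit false
set_option linter.dupNamespace false

open scoped MatrixGroups

open CongruenceSubgroup Matrix.SpecialLinearGroup
open Summit.BirchSwinnertonDyer.Rank1Residual.ManinAdditive.NineShiftEqualiser (slOf g0Of slOf_apply_00 slOf_apply_01
  slOf_apply_10 slOf_apply_11 slOf_mem_gamma0 g0Of_congr)

namespace Summit.BirchSwinnertonDyer.BirchSwinnertonDyer.Theorems.ManinLocalTwoThree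

namespace TwoShift

/-! ### §1. Vocabulary (any commutative coefficient ring `K`) -/

section Vocabulary

variable {K : Type*} [CommRing K]

/-- `φ : Γ₀(N) → K` is additive. [folklore] -/
def IsAdd {N : ℕ} (φ : Gamma0 N → K) : Prop :=
  ∀ γ δ : Gamma0 N, φ (γ * δ) = φ γ + φ δ

/-- `φ` is an `ε`-EIGENFUNCTION of the 2-shift: `φ(diag(2,1) γ diag(2,1)⁻¹) = ε·φ(γ)` for every `γ = (a b; 2c d) ∈ Γ₀(2N)`,
i.e. `φ(a, 2b; c, d) = ε·φ(a, b; 2c, d)`.  (`ε = 1`: 2-shift invariant; over `𝔽₄` with `ε³ = 1 ≠ ε`: the «ω-part».) [folklore] -/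
def IsShiftEigen {N : ℕ} (ε : K) (φ : Gamma0 N → K) : Prop :=
  ∀ (a b c d : ℤ) (hdet : a * d - b * (2 * c) = 1) (hc : (N : ℤ) ∣ c),
    φ (g0Of a (2 * b) c d (by linear_combination hdet) hc)
      = ε * φ (g0Of a b (2 * c) d hdet (Dvd.dvd.mul_left hc 2))

/-- `φ` is INVARIANT UNDER THE 2-SHIFT: `φ(a, 2b; c, d) = φ(a, b; 2c, d)` for every `(a b; 2c d) ∈ Γ₀(2N)`. [folklore] -/
def IsTwoShiftInvariant {N : ℕ} (φ : Gamma0 N → K) : Prop :=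
  ∀ (a b c d : ℤ) (hdet : a * d - b * (2 * c) = 1) (hc : (N : ℤ) ∣ c),
    φ (g0Of a (2 * b) c d (by linear_combination hdet) hc)
      = φ (g0Of a b (2 * c) d hdet (Dvd.dvd.mul_left hc 2))

/-- `φ` is INVARIANT UNDER THE 4-SHIFT: `φ(a, 4b; c, d) = φ(a, b; 4c, d)` for every `(a b; 4c d) ∈ Γ₀(4N)`. [folklore] -/
def IsFourShiftInvariant {N : ℕ} (φ : Gamma0 N → K) : Prop :=
  ∀ (a b c d : ℤ) (hdet : a * d - b * (4 * c) = 1) (hc : (N : ℤ) ∣ c),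
    φ (g0Of a (4 * b) c d (by linear_combination hdet) hc)
      = φ (g0Of a b (4 * c) d hdet (Dvd.dvd.mul_left hc 4))

/-- `φ` is INVARIANT UNDER THE 8-SHIFT: `φ(a, 8b; c, d) = φ(a, b; 8c, d)` for every `(a b; 8c d) ∈ Γ₀(8N)` — the group-side
shadow of the ratio-`8` degeneracy loops of the C2 consumer. [folklore] -/
def IsEightShiftInvariant {N : ℕ} (φ : Gamma0 N → K) : Prop :=
  ∀ (a b c d : ℤ) (hdet : a * d - b * (8 * c) = 1) (hc : (N : ℤ) ∣ c),
    φ (g0Of a (8 * b) c d (by linear_combination hdet) hc)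
      = φ (g0Of a b (8 * c) d hdet (Dvd.dvd.mul_left hc 8))

/-- `φ` is a DIAMOND class: it vanishes on `Γ₁(N)`. [folklore] -/
def IsDiamond {N : ℕ} (φ : Gamma0 N → K) : Prop :=
  ∀ (γ : SL(2, ℤ)) (hγ : γ ∈ Gamma1 N), φ ⟨γ, Gamma1_in_Gamma0 N hγ⟩ = 0

/-- `φ : Γ₀(N) → K` is the RESTRICTION of `w : Γ₀(M) → K` (entrywise; used with `M ∣ N`). [folklore] -/
def RestrictsFrom {M N : ℕ} (φ : Gamma0 N → K) (w : Gamma0 M → K) : Prop :=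
  ∀ (a b c d : ℤ) (hdet : a * d - b * c = 1) (hcN : (N : ℤ) ∣ c) (hcM : (M : ℤ) ∣ c),
    φ (g0Of a b c d hdet hcN) = w (g0Of a b c d hdet hcM)

/-- single-level schema: every additive `ε`-eigenfunction `Γ₀(N) → K` of the 2-shift vanishes. [folklore] -/
def ShiftEigenTrivialAt (N : ℕ) (ε : K) : Prop :=
  ∀ φ : Gamma0 N → K, IsAdd φ → IsShiftEigen ε φ → ∀ γ : Gamma0 N, φ γ = 0

end Vocabulary

/-- single-level schema of G₂: `K₂(N) = D(N)` over `𝔽₂`. [folklore] -/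
def TwoShiftInvariantIsDiamondAt (N : ℕ) : Prop :=
  ∀ φ : Gamma0 N → ZMod 2, IsAdd φ → IsTwoShiftInvariant φ → IsDiamond φ

/-- **LAW G₂ (the `p = 2` twin of E-es-96, EVERY level):** for `N ≥ 1`, every additive `φ : Γ₀(N) → 𝔽₂` invariant under the
2-shift `γ ↦ diag(2,1) γ diag(2,1)⁻¹` on `Γ₀(2N)` is a diamond class (`K₂(N) = D(N)`).  CENSUS: `dim K₂(N) = r₂((ℤ/N)ˣ)` at all
`N ≤ 35` (seat engine).  PROVED at every level in the sibling `…TwoShiftEqualiser.lean` modulo the single index-3 node; nothing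
asserted here. [conjecture — cell candidate, NOT a tree fact] -/
@[conjecture] def TwoShiftInvariantIsDiamond : Prop :=
  ∀ N : ℕ, 0 < N → TwoShiftInvariantIsDiamondAt N

/-- **LAW G₈ (the `p = 2` twin of E-es-94♯ with the consumer's ratio `t = 8`):** for `N ≥ 1`, every additive `φ : Γ₀(N) → 𝔽₂`
invariant under the 8-shift on `Γ₀(8N)` is a diamond class.  CENSUS: `dim K₈(N) = r₂((ℤ/N)ˣ)` at all 13 levels `4 ∣ N ≤ 48` and all
`N ≤ 15` (seat engine).  Nothing asserted here. [conjecture — cell candidate, NOT a tree fact] -/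
@[conjecture] def EightShiftInvariantIsDiamond : Prop :=
  ∀ N : ℕ, 0 < N → ∀ φ : Gamma0 N → ZMod 2, IsAdd φ → IsEightShiftInvariant φ → IsDiamond φ

/-! ### §2. Sanity: `D ⊆ K₂ ⊆ K₄ ⊆ K₈`, eigen bookkeeping, restriction -/

section Sanity

variable {K : Type*} [CommRing K] {N : ℕ}

/-- 2-shift invariance is the `ε = 1` eigen-condition. [folklore] -/
theorem isTwoShiftInvariant_iff_isShiftEigen_one (φ : Gamma0 N → K) :
    IsTwoShiftInvariant φ ↔ IsShiftEigen 1 φ := by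
  simp only [IsTwoShiftInvariant, IsShiftEigen, one_mul]

/-- An additive map kills `1`. [folklore] -/
theorem IsAdd.map_one {φ : Gamma0 N → K} (h : IsAdd φ) : φ 1 = 0 := by
  have := h 1 1
  rw [one_mul] at this
  have e : φ 1 + φ 1 - φ 1 = φ 1 - φ 1 := by rw [← this]
  simpa using e

/-- An additive map is odd. [folklore] -/
theorem IsAdd.map_inv {φ : Gamma0 N → K} (h : IsAdd φ) (γ : Gamma0 N) : φ γ⁻¹ = -φ γ := by
  have := h γ γ⁻¹
  rw [mul_inv_cancel, h.map_one] at this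
  exact (neg_eq_of_add_eq_zero_right this.symm).symm

/-- An additive map on natural powers. [folklore] -/
theorem IsAdd.map_pow {φ : Gamma0 N → K} (h : IsAdd φ) (γ : Gamma0 N) (n : ℕ) : φ (γ ^ n) = n * φ γ := by
  induction n with
  | zero => rw [pow_zero, h.map_one, Nat.cast_zero, zero_mul]
  | succ n ih => rw [pow_succ, h, ih, Nat.cast_succ]; ring

/-- In characteristic `2` an additive map kills squares. [folklore] -/
theorem IsAdd.map_sq_eq_zero {φ : Gamma0 N → K} (h : IsAdd φ) (h2 : (2 : K) = 0) (γ : Gamma0 N) :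
    φ (γ * γ) = 0 := by
  rw [h, ← two_mul, h2, zero_mul]

omit [CommRing K] in
/-- `K₂ ⊆ K₄`: the 4-shift is the 2-shift applied twice. [folklore] -/
theorem isFourShiftInvariant_of_isTwoShiftInvariant (φ : Gamma0 N → K) (h : IsTwoShiftInvariant φ) :
    IsFourShiftInvariant φ := by
  intro a b c d hdet hc
  have h1 := h a (2 * b) c d (by linear_combination hdet) hc
  have h2 := h a b (2 * c) d (by linear_combination hdet) (Dvd.dvd.mul_left hc 2)
  have e1 : g0Of (M := N) a (4 * b) c d (by linear_combination hdet) hc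
      = g0Of a (2 * (2 * b)) c d (by linear_combination hdet) hc :=
    g0Of_congr rfl (by ring) rfl rfl _ _ _ _
  have e2 : g0Of (M := N) a b (4 * c) d hdet (Dvd.dvd.mul_left hc 4)
      = g0Of a b (2 * (2 * c)) d (by linear_combination hdet) (Dvd.dvd.mul_left (Dvd.dvd.mul_left hc 2) 2) :=
    g0Of_congr rfl rfl (by ring) rfl _ _ _ _
  rw [e1, e2, h1]
  exact h2

omit [CommRing K] in
/-- `K₂ ⊆ K₈`: 2-shift invariance (hence 4-shift invariance) gives 8-shift invariance. [folklore] -/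
theorem isEightShiftInvariant_of_isTwoShiftInvariant (φ : Gamma0 N → K) (h : IsTwoShiftInvariant φ) :
    IsEightShiftInvariant φ := by
  have h4 := isFourShiftInvariant_of_isTwoShiftInvariant φ h
  intro a b c d hdet hc
  have h1 := h4 a (2 * b) c d (by linear_combination hdet) hc
  have h2 := h a b (4 * c) d (by linear_combination hdet) (Dvd.dvd.mul_left hc 4)
  have e1 : g0Of (M := N) a (8 * b) c d (by linear_combination hdet) hc
      = g0Of a (4 * (2 * b)) c d (by linear_combination hdet) hc :=
    g0Of_congr rfl (by ring) rfl rfl _ _ _ _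
  have e2 : g0Of (M := N) a b (8 * c) d hdet (Dvd.dvd.mul_left hc 8)
      = g0Of a b (2 * (4 * c)) d (by linear_combination hdet) (Dvd.dvd.mul_left (Dvd.dvd.mul_left hc 4) 2) :=
    g0Of_congr rfl rfl (by ring) rfl _ _ _ _
  rw [e1, e2, h1]
  exact h2

/-- `D ⊆ K^ε` only for `ε = 1`, but in general: the two matrices `(a 2b; c d)`, `(a b; 2c d)` differ by an element of `Γ₁(N)`
(same `d`, `N ∣ c`), so an additive DIAMOND class takes the same value on them. [folklore] -/
theorem isTwoShiftInvariant_of_isDiamond (φ : Gamma0 N → K) (hadd : IsAdd φ) (hD : IsDiamond φ) :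
    IsTwoShiftInvariant φ := by
  intro a b c d hdet hc
  set γ₁ : Gamma0 N := g0Of a (2 * b) c d (by linear_combination hdet) hc with hγ₁
  set γ₂ : Gamma0 N := g0Of a b (2 * c) d hdet (Dvd.dvd.mul_left hc 2) with hγ₂
  have hcN : ((c : ℤ) : ZMod N) = 0 := (ZMod.intCast_zmod_eq_zero_iff_dvd c N).mpr hc
  have had : ((a : ℤ) : ZMod N) * d = 1 := by
    have : ((a * d - b * (2 * c) : ℤ) : ZMod N) = 1 := by rw [hdet]; push_cast; rfl
    push_cast at this; rw [hcN] at this; simpa using this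
  have hmem : ((γ₁ * γ₂⁻¹ : Gamma0 N) : SL(2, ℤ)) ∈ Gamma1 N := by
    rw [Gamma1_mem]
    simp only [hγ₁, hγ₂, g0Of, slOf, Subgroup.coe_mul, Subgroup.coe_inv,
      Matrix.SpecialLinearGroup.coe_mul, Matrix.SpecialLinearGroup.coe_inv, Matrix.adjugate_fin_two,
      Matrix.mul_apply, Fin.sum_univ_two, Matrix.of_apply, Matrix.cons_val', Matrix.cons_val_zero,
      Matrix.cons_val_one, Matrix.empty_val']
    push_cast
    rw [hcN]
    refine ⟨?_, ?_, ?_⟩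
    · linear_combination had
    · linear_combination had
    · ring
  have hzero : φ (γ₁ * γ₂⁻¹) = 0 := by
    have := hD _ hmem
    have e : (γ₁ * γ₂⁻¹ : Gamma0 N) = ⟨((γ₁ * γ₂⁻¹ : Gamma0 N) : SL(2, ℤ)), Gamma1_in_Gamma0 N hmem⟩ :=
      Subtype.ext rfl
    rw [e]; exact this
  have key : γ₁ = (γ₁ * γ₂⁻¹) * γ₂ := by group
  calc φ γ₁ = φ ((γ₁ * γ₂⁻¹) * γ₂) := by rw [← key]
    _ = φ (γ₁ * γ₂⁻¹) + φ γ₂ := hadd _ _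
    _ = φ γ₂ := by rw [hzero, zero_add]

variable {M : ℕ}

omit [CommRing K] in
/-- **`RestrictsFrom` is pointwise restriction** along the inclusion `Γ₀(N) ≤ Γ₀(M)`, `M ∣ N`. [folklore] -/
theorem apply_eq_of_restrictsFrom (hMN : M * 1 ∣ N) {φ : Gamma0 N → K} {w : Gamma0 M → K}
    (h : RestrictsFrom φ w) (γ : Gamma0 N) :
    φ γ = w (Literature.NumberTheory.EllipticCurves.ModularForms.Gamma0.degeneracyConj M N 1 hMN γ) := by
  have hcN : (N : ℤ) ∣ (γ : SL(2, ℤ)) 1 0 := (ZMod.intCast_zmod_eq_zero_iff_dvd _ N).mp (Gamma0_mem.mp γ.2)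
  have hcM : (M : ℤ) ∣ (γ : SL(2, ℤ)) 1 0 := (Int.natCast_dvd_natCast.mpr (by simpa using hMN)).trans hcN
  have key := h ((γ : SL(2, ℤ)) 0 0) ((γ : SL(2, ℤ)) 0 1) ((γ : SL(2, ℤ)) 1 0) ((γ : SL(2, ℤ)) 1 1)
    (gamma0_det_entries γ) hcN hcM
  rw [g0Of_entries γ] at key
  rw [key]
  congr 1
  apply Subtype.ext
  rw [Literature.NumberTheory.EllipticCurves.ModularForms.Gamma0.coe_degeneracyConj_one hMN γ,
    ← coe_g0Of_eq _ _ _ _ (gamma0_det_entries γ) hcN hcM, g0Of_entries γ]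

/-- **Restriction of a diamond class is a diamond class** (`Γ₁(N) ≤ Γ₁(M)` for `M ∣ N`). [folklore] -/
theorem isDiamond_of_restrictsFrom (hMN : M ∣ N) {φ : Gamma0 N → K} {w : Gamma0 M → K}
    (hres : RestrictsFrom φ w) (hw : IsDiamond w) : IsDiamond φ := by
  intro γ hγ
  have hMN' : M * 1 ∣ N := by simpa using hMN
  rw [apply_eq_of_restrictsFrom hMN' hres]
  obtain ⟨h00, h11, h10⟩ := (Gamma1_mem N γ).mp hγ
  have hγM : γ ∈ Gamma1 M := by
    rw [Gamma1_mem]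
    refine ⟨?_, ?_, ?_⟩
    · have := intCast_zmod_eq_of_dvd hMN (x := (γ 0 0 : ℤ)) (y := 1) (by push_cast; exact h00)
      push_cast at this; exact this
    · have := intCast_zmod_eq_of_dvd hMN (x := (γ 1 1 : ℤ)) (y := 1) (by push_cast; exact h11)
      push_cast at this; exact this
    · have := intCast_zmod_eq_of_dvd hMN (x := (γ 1 0 : ℤ)) (y := 0) (by push_cast; exact h10)
      push_cast at this; exact this
  have e : (Literature.NumberTheory.EllipticCurves.ModularForms.Gamma0.degeneracyConj M N 1 hMN' ⟨γ, Gamma1_in_Gamma0 N hγ⟩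
      : Gamma0 M) = ⟨γ, Gamma1_in_Gamma0 M hγM⟩ := by
    apply Subtype.ext
    rw [Literature.NumberTheory.EllipticCurves.ModularForms.Gamma0.coe_degeneracyConj_one]
  rw [e]
  exact hw γ hγM

/-- Restriction of an identically vanishing map vanishes. [folklore] -/
theorem eq_zero_of_restrictsFrom (hMN : M ∣ N) {φ : Gamma0 N → K} {w : Gamma0 M → K}
    (hres : RestrictsFrom φ w) (hw : ∀ δ : Gamma0 M, w δ = 0) (γ : Gamma0 N) : φ γ = 0 := by
  have hMN' : M * 1 ∣ N := by simpa using hMN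
  rw [apply_eq_of_restrictsFrom hMN' hres, hw]

omit [CommRing K] in
/-- transitivity of restriction along `L ∣ M ∣ N` (only `M ∣ N` is needed). [folklore] -/
theorem restrictsFrom_trans {L : ℕ} (hMN : M ∣ N) {φ : Gamma0 N → K} {w : Gamma0 M → K}
    {v : Gamma0 L → K} (h1 : RestrictsFrom φ w) (h2 : RestrictsFrom w v) : RestrictsFrom φ v := by
  intro a b c d hdet hcN hcL
  have hcM : (M : ℤ) ∣ c := dvd_trans (Int.natCast_dvd_natCast.mpr hMN) hcN
  rw [h1 a b c d hdet hcN hcM, h2 a b c d hdet hcM hcL]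

end Sanity

/-! ### §3. Parity facts at an even level -/

section ModTwo

variable {M : ℕ}

/-- For `(a b; c d) ∈ Γ₀(M)` with `2 ∣ M`: `a`, `d` are odd — `2 ∣ d − a`, `2 ∣ a·a − 1`, `2 ∣ d·d − 1`. [folklore] -/
theorem two_dvd_of_det (h2 : 2 ∣ M) {a b c d : ℤ} (h : a * d - b * c = 1) (hc : (M : ℤ) ∣ c) :
    (2 : ℤ) ∣ d - a ∧ (2 : ℤ) ∣ a * a - 1 ∧ (2 : ℤ) ∣ d * d - 1 := by
  obtain ⟨k, hk⟩ : (2 : ℤ) ∣ c := (Int.natCast_dvd_natCast.mpr h2).trans hc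
  subst hk
  have had : a * d = 1 + 2 * (b * k) := by linear_combination h
  have ha : a % 2 = 1 ∨ a % 2 = -1 ∨ a % 2 = 0 := by omega
  have key : ¬ (2 : ℤ) ∣ a * d := by
    rw [had]; intro ⟨t, ht⟩; omega
  have ha1 : ¬ (2 : ℤ) ∣ a := fun h2a => key (Dvd.dvd.mul_right h2a d)
  have hd1 : ¬ (2 : ℤ) ∣ d := fun h2d => key (Dvd.dvd.mul_left h2d a)
  rw [Int.two_dvd_ne_zero] at ha1 hd1
  refine ⟨?_, ?_, ?_⟩
  · exact Int.ModEq.dvd (show a ≡ d [ZMOD 2] by rw [Int.ModEq, ha1, hd1])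
  · have : a * a ≡ 1 * 1 [ZMOD 2] := Int.ModEq.mul (by rw [Int.ModEq, ha1]; rfl) (by rw [Int.ModEq, ha1]; rfl)
    exact (Int.ModEq.dvd this.symm)
  · have : d * d ≡ 1 * 1 [ZMOD 2] := Int.ModEq.mul (by rw [Int.ModEq, hd1]; rfl) (by rw [Int.ModEq, hd1]; rfl)
    exact (Int.ModEq.dvd this.symm)

/-- DICHOTOMY for the `Q₁`-decomposition: with `2 ∣ M`, `c = M c₀`, `ad − bc = 1`, one of `c₀`, `c₀ − c − d` is even. [folklore] -/
theorem dichotomy (h2 : 2 ∣ M) {a b c d c₀ : ℤ} (h : a * d - b * c = 1) (hc₀ : c = M * c₀) :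
    (2 : ℤ) ∣ c₀ ∨ (2 : ℤ) ∣ c₀ - c - d := by
  obtain ⟨-, -, hdd⟩ := two_dvd_of_det h2 h ⟨c₀, hc₀⟩
  have hc2 : (2 : ℤ) ∣ c := (Int.natCast_dvd_natCast.mpr h2).trans ⟨c₀, hc₀⟩
  rcases Int.emod_two_eq_zero_or_one c₀ with h0 | h0
  · exact Or.inl (Int.dvd_of_emod_eq_zero h0)
  · right
    have hd : d % 2 = 1 := by
      have h1 : Odd (d * d) := by
        rcases Int.even_or_odd (d * d) with he | ho
        · exact absurd ((Int.even_sub.mp (even_iff_two_dvd.mpr hdd)).mp he) Int.not_even_one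
        · exact ho
      exact Int.odd_iff.mp (Int.odd_mul.mp h1).1
    obtain ⟨u, hu⟩ := hc2
    clear hdd hc₀ h
    rw [Int.dvd_iff_emod_eq_zero]
    omega

end ModTwo

end TwoShift

end Summit.BirchSwinnertonDyer.BirchSwinnertonDyer.Theorems.ManinLocalTwoThree
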